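import Literature.Geometry.Lorentzian.DiagonalMetricCoord
import HarnessLib

/-!
# The polarized Gowdy vacuum equations: the algebraic identity behind `Ric = 0`

Support file (everything proved, no named facts) for the explicit vacuum spacetime of
`Literature.Geometry.Lorentzian.christodoulou_trapped_surface_formation_holds`.

For the **polarized Gowdy** (Einstein–Rosen) metric in areal coordinates
`g = t^{-1/2} e^{λ/2} (−dt² + dθ²) + t (e^{P} dξ² + e^{−P} dζ²)`, `t > 0`,
the vacuum Einstein equations are equivalent to the Euler–Poisson–Darboux equation
`P_tt + P_t/t − P_θθ = 0` together with `λ_t = t (P_t² + P_θ²)`, `λ_θ = 2 t P_t P_θ`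
(Gowdy 1974, §II; Isenberg–Moncrief 1990, (4)–(5); Chruściel 1990, §2; Ringström 2009, §24.1).
This file proves the *algebraic core* of the implication "Gowdy equations ⇒ `Ric = 0`": writing
the components as `(g₀, g₁, g₂, g₃) = (−A, A, B, C)` with `A = e^{a}`, `B = e^{b}`, `C = e^{c}`,
`a = −½ log t + λ/2`, `b = log t + P`, `c = log t − P`, the first and second partials of the `gᵢ`
are `∂_β gᵢ = gᵢ ∂_β uᵢ`, `∂_α ∂_β gᵢ = gᵢ (∂_α uᵢ ∂_β uᵢ + ∂_α∂_β uᵢ)` (tables `Gowdy.d1`,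
`Gowdy.d2` built from the `P`-jet `(P_t, P_θ, P_tθ, P_θθ)` after elimination of `P_tt` and of
the `λ`-jet by the Gowdy equations), and `Gowdy.ricci_core` states that the coordinate Ricci form
of `DiagonalMetricCoord.lean` (`MetricCoord.ricAt_diagMetric_eb`) then vanishes identically:
sixteen rational identities in `(t, A, B, C, P_t, P_θ, P_tθ, P_θθ)`, checked by `field_simp`/`ring`.
The analytic half (the partials of the actual metric functions are these tables) is
`GowdyPolarizedVacuum.lean`.

## References

* R. H. Gowdy, *Vacuum spacetimes with two-parameter spacelike isometry groups and compact
  invariant hypersurfaces: topologies and boundary conditions*, Ann. Phys. 83 (1974) 203–241, §II.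
* J. Isenberg, V. Moncrief, *Asymptotic behavior of the gravitational field and the nature of
  singularities in Gowdy spacetimes*, Ann. Phys. 199 (1990) 84–122, eqs. (4)–(5).
* H. Ringström, *The Cauchy Problem in General Relativity*, EMS 2009, §24.1 (polarized Gowdy).
* B. O'Neill, *Semi-Riemannian geometry*, 1983, Ch. 3, Lemma 3.38, Lemma 3.52. [ONeill1983]
-/

noncomputable section

open Finset

namespace Literature.Geometry.Lorentzian

namespace Gowdy

open MetricCoord

variable (t A B C Pt Pθ Ptθ Pθθ : ℝ)

/-- `P_tt` eliminated by the Euler–Poisson–Darboux equation `P_tt = P_θθ − P_t/t`.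
[cite: IsenbergMoncrief1990, (4)] -/
def Ptt : ℝ := Pθθ - Pt / t

/-- The `λ`-jet from the Gowdy equations `λ_t = t(P_t² + P_θ²)`, `λ_θ = 2tP_tP_θ` and their
derivatives: `(λ_t, λ_θ, λ_tt, λ_tθ, λ_θθ)`. [cite: IsenbergMoncrief1990, (5)] -/
def Lt : ℝ := t * (Pt ^ 2 + Pθ ^ 2)
/-- `λ_θ = 2 t P_t P_θ`. [cite: IsenbergMoncrief1990, (5)] -/
def Lθ : ℝ := 2 * t * Pt * Pθ
/-- `λ_tt = ∂_t (t (P_t² + P_θ²))`. [cite: IsenbergMoncrief1990, (5)] -/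
def Ltt : ℝ := (Pt ^ 2 + Pθ ^ 2) + t * (2 * Pt * Ptt t Pt Pθθ + 2 * Pθ * Ptθ)
/-- `λ_tθ = ∂_θ (t (P_t² + P_θ²))`. [cite: IsenbergMoncrief1990, (5)] -/
def Ltθ : ℝ := t * (2 * Pt * Ptθ + 2 * Pθ * Pθθ)
/-- `λ_θθ = ∂_θ (2 t P_t P_θ)`. [cite: IsenbergMoncrief1990, (5)] -/
def Lθθ : ℝ := 2 * t * (Ptθ * Pθ + Pt * Pθθ)

/-- First partials `∂_β uᵢ` of the logarithms `u = (a, a, b, c)` of the metric entries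
(`a = −½ log t + λ/2`, `b = log t + P`, `c = log t − P`), indices `β = 0 (t), 1 (θ), 2, 3`.
[cite: IsenbergMoncrief1990, (4)–(5)] -/
def uFst : Fin 4 → Fin 4 → ℝ :=
  ![![-1 / (2 * t) + Lt t Pt Pθ / 2, Lθ t Pt Pθ / 2, 0, 0],
    ![-1 / (2 * t) + Lt t Pt Pθ / 2, Lθ t Pt Pθ / 2, 0, 0],
    ![1 / t + Pt, Pθ, 0, 0],
    ![1 / t - Pt, -Pθ, 0, 0]]

/-- Second partials `∂_α ∂_β a` of `a = −½ log t + λ/2`. [cite: IsenbergMoncrief1990, (5)] -/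
def aSnd : Fin 4 → Fin 4 → ℝ :=
  ![![1 / (2 * t ^ 2) + Ltt t Pt Pθ Ptθ Pθθ / 2, Ltθ t Pt Pθ Ptθ Pθθ / 2, 0, 0],
    ![Ltθ t Pt Pθ Ptθ Pθθ / 2, Lθθ t Pt Pθ Ptθ Pθθ / 2, 0, 0],
    ![0, 0, 0, 0], ![0, 0, 0, 0]]

/-- Second partials `∂_α ∂_β b` of `b = log t + P`. [cite: IsenbergMoncrief1990, (4)] -/
def bSnd : Fin 4 → Fin 4 → ℝ :=
  ![![-1 / t ^ 2 + Ptt t Pt Pθθ, Ptθ, 0, 0], ![Ptθ, Pθθ, 0, 0], ![0, 0, 0, 0], ![0, 0, 0, 0]]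

/-- Second partials `∂_α ∂_β c` of `c = log t − P`. [cite: IsenbergMoncrief1990, (4)] -/
def cSnd : Fin 4 → Fin 4 → ℝ :=
  ![![-1 / t ^ 2 - Ptt t Pt Pθθ, -Ptθ, 0, 0], ![-Ptθ, -Pθθ, 0, 0], ![0, 0, 0, 0], ![0, 0, 0, 0]]

/-- Second partials `∂_α ∂_β uᵢ`, `u = (a, a, b, c)`. [cite: IsenbergMoncrief1990, (4)–(5)] -/
def uSnd : Fin 4 → Fin 4 → Fin 4 → ℝ :=
  ![aSnd t Pt Pθ Ptθ Pθθ, aSnd t Pt Pθ Ptθ Pθθ, bSnd t Pt Ptθ Pθθ, cSnd t Pt Ptθ Pθθ]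

/-- The metric entries `(g₀, g₁, g₂, g₃) = (−A, A, B, C)`. [cite: IsenbergMoncrief1990, (3)] -/
def gval : Fin 4 → ℝ := ![-A, A, B, C]

/-- First partials of the metric entries: `∂_β gᵢ = gᵢ ∂_β uᵢ`. [folklore] -/
def d1 (i β : Fin 4) : ℝ := gval A B C i * uFst t Pt Pθ i β

/-- Second partials of the metric entries: `∂_α ∂_β gᵢ = gᵢ (∂_α uᵢ ∂_β uᵢ + ∂_α ∂_β uᵢ)`.
[folklore] -/
def d2 (α i β : Fin 4) : ℝ :=
  gval A B C i * (uFst t Pt Pθ i α * uFst t Pt Pθ i β + uSnd t Pt Pθ Ptθ Pθθ i α β)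

/-- **The algebraic core of "polarized Gowdy equations ⇒ `Ric = 0`".** With the tables `d1`, `d2`
of first and second partials of `(−A, A, B, C)` expressed through the `P`-jet by the Gowdy
equations, the coordinate Ricci form of an orthogonal metric
(`MetricCoord.ricAt_diagMetric_eb`: `Ric(e_b,e_c) = ∑ₐ gₐ⁻¹ (½(kd(∂ₐ∂g) b c a − kd(∂_b∂g) a c a)
 − ∑ₘ kd(∂g) b c m · kd(∂g) a a m /(4gₘ) + ∑ₘ kd(∂g) a c m · kd(∂g) b a m /(4gₘ))`) vanishes for all
`b, c`, whenever `t, A, B, C ≠ 0`. [cite: IsenbergMoncrief1990, (3)–(5)] -/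
theorem ricci_core (ht : t ≠ 0) (hA : A ≠ 0) (hB : B ≠ 0) (hC : C ≠ 0) (b c : Fin 4) :
    ∑ a, (gval A B C a)⁻¹ *
        (2⁻¹ * (kd (fun i β ↦ d2 t A B C Pt Pθ Ptθ Pθθ a i β) b c a
            - kd (fun i β ↦ d2 t A B C Pt Pθ Ptθ Pθθ b i β) a c a)
          - ∑ m, kd (d1 t A B C Pt Pθ) b c m * kd (d1 t A B C Pt Pθ) a a m / (4 * gval A B C m)
          + ∑ m, kd (d1 t A B C Pt Pθ) a c m * kd (d1 t A B C Pt Pθ) b a m / (4 * gval A B C m))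
      = 0 := by
  fin_cases b <;> fin_cases c <;>
    simp [Fin.sum_univ_four, kd, d1, d2, gval, uFst, uSnd, aSnd, bSnd, cSnd,
      Ptt, Lt, Lθ, Ltt, Ltθ, Lθθ] <;>
    field_simp <;> ring

end Gowdy

end Literature.Geometry.Lorentzian
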